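import Summits.AtomisticToContinuum.HydrodynamicLimit.Theorems.JParityClosureOddContactSymmetryCollisionWindows
import Summits.AtomisticToContinuum.HydrodynamicLimit.Theorems.JParityClosureOddContactSymmetryWindowKinematics
import Summits.AtomisticToContinuum.HydrodynamicLimit.Theorems.JParityClosureOddContactSymmetryGibbsInvariance
import Literature.MathematicalPhysics.KineticTheory.HardSphereBBGKYLiouvilleFlow
import Literature.MathematicalPhysics.KineticTheory.EvenStatTruncationBound
import Literature.MathematicalPhysics.KineticTheory.HardSphereUniformGas
import HarnessLib

/-!
# Window events of the collision count under the homogeneous Gibbs law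
# (rung-0 collision-count bound, part 4a; crux `JParityClosure.OddContactSymmetry`,
# stmt-AtomisticToContinuum-13078, line `equilibrium-rung-mean-variance`, transfer debt "tightness")

Lead prover r-1 of the crux.  The measure-side bookkeeping of the window argument for an ABSTRACT
hard-sphere flow `Φ` and CONSTANT profiles: the homogeneous Gibbs law does not charge the bad set
(`localGibbsLaw_compl_good_eq_zero`, tree); speeds along good orbits are bounded on energy shells
(`norm_vel_flow_le`); the window-`0` events `{count[0,δ] ≥ 1}`, `{E ≤ V²/2} ∩ {count[0,δ] ≥ 2}`
(through the measurable proxy `𝟙_good · numCollisions`) are contained in the STATIC close-pair events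
of the window kinematics D1/D2 (`setOf_one_le_numCollisions_subset`,
`setOf_two_le_numCollisions_subset`); and by invariance of the law and of the energy, the window-`k`
events have the probabilities of the window-`0` events (`localGibbsLaw_const_eq_of_inter_good`,
`localGibbsLaw_window_one`, `localGibbsLaw_window_two`).  Consumed by `…CollisionCountBound`.

References: Gallagher–Saint-Raymond–Texier 2013, Prop. 4.1.1, Lemma 4.1.2; Spohn 1991, Part I §2.3.
-/

noncomputable section

open MeasureTheory Set Filter Topology
open scoped ENNReal InnerProductSpace BigOperators

namespace Summit.AtomisticToContinuum.HydrodynamicLimit.Theorems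

open Literature.Analysis.FluidPDE Literature.MathematicalPhysics.KineticTheory

section Assembly

variable {σ a θ : ℝ} {u : V3} {N : ℕ}
  (Φ : HardSphereFlow (Torus.geometry (Fin 3)) (hsDiameter σ N) (N + 1))

/-- On the good set, a bound `E(z) ≤ V²/2` on the kinetic energy bounds every speed along the orbit by
`V` (conservation of energy, `HardSphereFlow.configEnergy_flow`). [folklore] -/
theorem norm_vel_flow_le {z : Config (N + 1) (Fin 3) T3} (hz : z ∈ Φ.good) {V : ℝ} (hV : 0 ≤ V)
    (hE : configEnergy z ≤ V ^ 2 / 2) (s : ℝ) (k : Fin (N + 1)) :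
    ‖(Φ.flow s z k).2‖ ≤ V := by
  have hEs : configEnergy (Φ.flow s z) ≤ V ^ 2 / 2 := by rw [Φ.configEnergy_flow hz s]; exact hE
  have hk : ‖(Φ.flow s z k).2‖ ^ 2 ≤ ∑ i, ‖(Φ.flow s z i).2‖ ^ 2 :=
    Finset.single_le_sum (f := fun i => ‖(Φ.flow s z i).2‖ ^ 2) (fun i _ => sq_nonneg _)
      (Finset.mem_univ k)
  have hsum : ∑ i, ‖(Φ.flow s z i).2‖ ^ 2 = 2 * configEnergy (Φ.flow s z) := by
    rw [configEnergy]; ring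
  have h2 : ‖(Φ.flow s z k).2‖ ^ 2 ≤ V ^ 2 := by nlinarith
  exact (pow_le_pow_iff_left₀ (norm_nonneg _) hV two_ne_zero).1 h2

variable {Φ}

/-- **The one-collision window event is a close-pair event** (D1 read at the initial datum): if the
orbit of a good datum `z` has a collision in `[0, δ]`, then `z` has a pair at distance in
`[ε, ε + (‖vᵢ‖+‖vⱼ‖)δ]`. Stated for the measurable proxy `𝟙_good · numCollisions ≥ 1`. [folklore] -/
theorem setOf_one_le_numCollisions_subset (hσ : 0 < σ) (hσ2 : σ < 2⁻¹) {δ : ℝ} (hδ : 0 ≤ δ) :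
    {z | 1 ≤ Φ.good.indicator (fun z => (numCollisions (Torus.geometry (Fin 3)) (hsDiameter σ N)
        (fun s => Φ.flow s z) 0 δ : ℝ≥0∞)) z} ⊆
      {z | ∃ i j : Fin (N + 1), i ≠ j ∧ hsDiameter σ N ≤ Torus.euclidDist (z i).1 (z j).1 ∧
        Torus.euclidDist (z i).1 (z j).1 ≤ hsDiameter σ N + (‖(z i).2‖ + ‖(z j).2‖) * δ} := by
  intro z hz
  have hε : 0 < hsDiameter σ N := hsDiameter_pos hσ N
  have hε2 : hsDiameter σ N < 2⁻¹ := (hsDiameter_le hσ.le N).trans_lt hσ2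
  by_cases hg : z ∈ Φ.good
  · simp only [mem_setOf_eq, indicator_of_mem hg, Nat.one_le_cast] at hz
    have hne : (collisionTimes (Torus.geometry (Fin 3)) (hsDiameter σ N) (fun s => Φ.flow s z) ∩
        Icc 0 (0 + δ)).Nonempty := by
      rw [zero_add]
      refine Set.nonempty_of_ncard_ne_zero ?_
      rw [← numCollisions]
      exact Nat.one_le_iff_ne_zero.1 hz
    obtain ⟨i, j, hij, h1, h2⟩ :=
      exists_close_pair_of_collision hε hε2 (Φ.isTrajectory z hg) hδ hne
    rw [Φ.flow_zero z hg] at h1 h2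
    exact ⟨i, j, hij, h1, h2⟩
  · simp [indicator_of_notMem hg] at hz

/-- **The two-collision window event on an energy shell is a two-close-pairs event** (D2 read at the
initial datum, speeds bounded by energy conservation). [folklore] -/
theorem setOf_two_le_numCollisions_subset (hσ : 0 < σ) (hσ2 : σ < 2⁻¹) {V δ : ℝ} (hV : 0 ≤ V)
    (hδ : 0 ≤ δ) (hVδ : 2 * V * δ < (2⁻¹ - hsDiameter σ N) / 2) :
    {z : Config (N + 1) (Fin 3) T3 | configEnergy z ≤ V ^ 2 / 2} ∩
      {z | 2 ≤ Φ.good.indicator (fun z => (numCollisions (Torus.geometry (Fin 3)) (hsDiameter σ N)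
        (fun s => Φ.flow s z) 0 δ : ℝ≥0∞)) z} ⊆
      {z | ∃ i j k l : Fin (N + 1), i ≠ j ∧ k ≠ l ∧ ({i, j} : Finset (Fin (N + 1))) ≠ {k, l} ∧
        Torus.euclidDist (z i).1 (z j).1 ≤ hsDiameter σ N + 2 * V * δ ∧
        Torus.euclidDist (z k).1 (z l).1 ≤ hsDiameter σ N + 2 * V * δ} := by
  rintro z ⟨hzE, hz⟩
  have hε : 0 < hsDiameter σ N := hsDiameter_pos hσ N
  have hε2 : hsDiameter σ N < 2⁻¹ := (hsDiameter_le hσ.le N).trans_lt hσ2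
  by_cases hg : z ∈ Φ.good
  · simp only [mem_setOf_eq, indicator_of_mem hg, Nat.ofNat_le_cast] at hz
    have h2 : 1 < (collisionTimes (Torus.geometry (Fin 3)) (hsDiameter σ N) (fun s => Φ.flow s z) ∩
        Icc 0 (0 + δ)).ncard := by
      rw [zero_add, ← numCollisions]; exact hz
    obtain ⟨t₁, t₂, ht₁, ht₂, hne⟩ :=
      (Set.one_lt_ncard_iff ((Φ.isTrajectory z hg).locFinite 0 (0 + δ))).1 h2
    have hspeed : ∀ s k, ‖(Φ.flow s z k).2‖ ≤ V := norm_vel_flow_le Φ hg hV hzE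
    obtain ⟨i, j, k, l, hij, hkl, hne', h1, h2'⟩ :=
      exists_two_close_pairs_of_two_collisions hε hε2 (Φ.isTrajectory z hg) hspeed hδ hVδ ht₁ ht₂ hne
    rw [Φ.flow_zero z hg] at h1 h2'
    exact ⟨i, j, k, l, hij, hkl, hne', h1, h2'⟩
  · simp [indicator_of_notMem hg] at hz

/-- **Flow shift of the window events**: for a good datum, the count of window `k` of the orbit of `z`
is the count of window `0` of the orbit of `Φ_{kδ} z`. [folklore] -/
theorem indicator_numCollisions_window (z : Config (N + 1) (Fin 3) T3) (hz : z ∈ Φ.good) (δ : ℝ) (k : ℕ) :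
    Φ.good.indicator (fun z => (numCollisions (Torus.geometry (Fin 3)) (hsDiameter σ N)
        (fun s => Φ.flow s z) (k * δ) ((k + 1) * δ) : ℝ≥0∞)) z =
      Φ.good.indicator (fun z => (numCollisions (Torus.geometry (Fin 3)) (hsDiameter σ N)
        (fun s => Φ.flow s z) 0 δ : ℝ≥0∞)) (Φ.flow (k * δ) z) := by
  rw [indicator_of_mem hz, indicator_of_mem (Φ.mapsTo_good _ hz), numCollisions_flow_shift Φ hz,
    zero_add, show δ + k * δ = (k + 1) * δ by ring]


/-- The kinetic energy is a measurable function of the configuration. [folklore] -/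
theorem measurable_configEnergy_T3 :
    Measurable (configEnergy : Config (N + 1) (Fin 3) T3 → ℝ) := by
  unfold configEnergy
  exact measurable_const.mul
    (Finset.measurable_sum _ fun i _ => (measurable_pi_apply i).snd.norm.pow_const 2)

/-- **Invariance transfer**: if two events agree on the good set up to a flow map,
`S ∩ good = Φ_t⁻¹ T ∩ good` with `T` measurable, they have the same homogeneous Gibbs probability
(`localGibbsLaw_const_preimage_flow` and the nullity of the bad set). [folklore] -/
theorem localGibbsLaw_const_eq_of_inter_good (t : ℝ) {S T : Set (Config (N + 1) (Fin 3) T3)}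
    (hT : MeasurableSet T) (hST : S ∩ Φ.good = Φ.flow t ⁻¹' T ∩ Φ.good) :
    localGibbsLaw σ (fun _ => a) (fun _ => u) (fun _ => θ) N Φ S =
      localGibbsLaw σ (fun _ => a) (fun _ => u) (fun _ => θ) N Φ T := by
  have h0 := localGibbsLaw_compl_good_eq_zero (a₀ := fun _ => a) (θ₀ := fun _ => θ) (u₀ := fun _ => u) Φ
  rw [← measure_inter_conull h0, hST, measure_inter_conull h0,
    localGibbsLaw_const_preimage_flow σ a θ u N Φ t hT]

/-- The window-`k` one-collision event has the probability of the window-`0` event. [folklore] -/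
theorem localGibbsLaw_window_one (hσ : 0 < σ) (hσ2 : σ < 2⁻¹) (δ : ℝ) (k : ℕ) :
    localGibbsLaw σ (fun _ => a) (fun _ => u) (fun _ => θ) N Φ
        {z | 1 ≤ Φ.good.indicator (fun z => (numCollisions (Torus.geometry (Fin 3)) (hsDiameter σ N)
          (fun s => Φ.flow s z) (k * δ) ((k + 1) * δ) : ℝ≥0∞)) z} =
      localGibbsLaw σ (fun _ => a) (fun _ => u) (fun _ => θ) N Φ
        {z | 1 ≤ Φ.good.indicator (fun z => (numCollisions (Torus.geometry (Fin 3)) (hsDiameter σ N)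
          (fun s => Φ.flow s z) 0 δ : ℝ≥0∞)) z} := by
  have hε2 : hsDiameter σ N < 2⁻¹ := (hsDiameter_le hσ.le N).trans_lt hσ2
  refine localGibbsLaw_const_eq_of_inter_good (k * δ)
    (measurableSet_le measurable_const (measurable_indicator_numCollisions hε2 Φ 0 δ)) ?_
  ext z
  simp only [mem_inter_iff, mem_setOf_eq, mem_preimage]
  constructor
  · rintro ⟨h1, hz⟩
    exact ⟨by rwa [← indicator_numCollisions_window z hz δ k], hz⟩
  · rintro ⟨h1, hz⟩
    exact ⟨by rwa [indicator_numCollisions_window z hz δ k], hz⟩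

/-- The window-`k` two-collision event on an energy shell has the probability of the window-`0`
event (energy is conserved along good orbits). [folklore] -/
theorem localGibbsLaw_window_two (hσ : 0 < σ) (hσ2 : σ < 2⁻¹) (V δ : ℝ) (k : ℕ) :
    localGibbsLaw σ (fun _ => a) (fun _ => u) (fun _ => θ) N Φ
        ({z : Config (N + 1) (Fin 3) T3 | configEnergy z ≤ V ^ 2 / 2} ∩
          {z | 2 ≤ Φ.good.indicator (fun z => (numCollisions (Torus.geometry (Fin 3)) (hsDiameter σ N)
            (fun s => Φ.flow s z) (k * δ) ((k + 1) * δ) : ℝ≥0∞)) z}) =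
      localGibbsLaw σ (fun _ => a) (fun _ => u) (fun _ => θ) N Φ
        ({z : Config (N + 1) (Fin 3) T3 | configEnergy z ≤ V ^ 2 / 2} ∩
          {z | 2 ≤ Φ.good.indicator (fun z => (numCollisions (Torus.geometry (Fin 3)) (hsDiameter σ N)
            (fun s => Φ.flow s z) 0 δ : ℝ≥0∞)) z}) := by
  have hε2 : hsDiameter σ N < 2⁻¹ := (hsDiameter_le hσ.le N).trans_lt hσ2
  refine localGibbsLaw_const_eq_of_inter_good (k * δ)
    ((measurableSet_le measurable_configEnergy_T3 measurable_const).inter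
      (measurableSet_le measurable_const (measurable_indicator_numCollisions hε2 Φ 0 δ))) ?_
  ext z
  simp only [mem_inter_iff, mem_setOf_eq, mem_preimage]
  constructor
  · rintro ⟨⟨hE, h2⟩, hz⟩
    exact ⟨⟨by rwa [Φ.configEnergy_flow hz], by rwa [← indicator_numCollisions_window z hz δ k]⟩, hz⟩
  · rintro ⟨⟨hE, h2⟩, hz⟩
    exact ⟨⟨by rwa [Φ.configEnergy_flow hz] at hE, by rwa [indicator_numCollisions_window z hz δ k]⟩, hz⟩

/-- **Registered helper stub `stub_collisionWindowEvents`** of crux stmt-AtomisticToContinuum-13078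
(rung-0 collision-count bound, part 4a: the two-collision window event on an energy shell is a static
two-close-pairs event of the initial datum; = `setOf_two_le_numCollisions_subset` in signature form).
[folklore] -/
theorem stub_collisionWindowEvents :
    ∀ (σ : ℝ) (N : ℕ) (Φ : HardSphereFlow (Torus.geometry (Fin 3)) (hsDiameter σ N) (N + 1)) (V δ : ℝ), 0 < σ → σ < 2⁻¹ → 0 ≤ V → 0 ≤ δ → 2 * V * δ < (2⁻¹ - hsDiameter σ N) / 2 → {z : Config (N + 1) (Fin 3) T3 | configEnergy z ≤ V ^ 2 / 2} ∩ {z | 2 ≤ Φ.good.indicator (fun z => (numCollisions (Torus.geometry (Fin 3)) (hsDiameter σ N) (fun s => Φ.flow s z) 0 δ : ℝ≥0∞)) z} ⊆ {z | ∃ i j k l : Fin (N + 1), i ≠ j ∧ k ≠ l ∧ ({i, j} : Finset (Fin (N + 1))) ≠ {k, l} ∧ Torus.euclidDist (z i).1 (z j).1 ≤ hsDiameter σ N + 2 * V * δ ∧ Torus.euclidDist (z k).1 (z l).1 ≤ hsDiameter σ N + 2 * V * δ} :=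
  fun _σ _N _Φ _V _δ hσ hσ2 hV hδ hVδ => setOf_two_le_numCollisions_subset hσ hσ2 hV hδ hVδ

end Assembly

end Summit.AtomisticToContinuum.HydrodynamicLimit.Theorems

end
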